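import Mathlib
import HarnessLib

/-!
# The Krasnoselskij (Krasnosel'skiĭ–Mann, averaged) iteration of a nonexpansive map in Hilbert space

Literature anchor (statements and proofs follow the source; nothing here is new mathematics):

* [Ber07] V. Berinde, *Iterative Approximation of Fixed Points*, 2nd ed., Lecture Notes in Math. 1912,
  Springer 2007, doi:10.1007/978-3-540-72234-2 (held: `lit` key
  `book:berinde2007-iterative-approximation-fixed-points`), Chapter 3 (*The Krasnoselskij iteration*),
  §3.1: the averaged map `U_λ = (1 − λ) I + λ T` ((2) in the proof of Thm 3.2) and the iteration
  `x_{n+1} = (1 − λ) x_n + λ T x_n` ((1)); **Theorem 3.2** (Hilbert space `H`, `T` nonexpansive with a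
  fixed point `p`; the proof establishes `‖x_{n+1} − p‖² + a²‖x_n − T x_n‖² ≤ ‖x_n − p‖²` for
  `a² ≤ λ(1 − λ)`, hence `Σ ‖x_n − T x_n‖² < ∞`, `‖x_n − T x_n‖ → 0`, `‖x_{n+1} − p‖ ≤ ‖x_n − p‖`, and:
  if a subsequence converges strongly to some `q` then `T q = q` and the whole sequence converges to
  `q` — there under the name "demicompact"); **Remark 2** after it (asymptotic regularity
  `x_n − x_{n+1} → 0`, (3)); **Remark 3** (the iteration is the Picard iteration of `U_λ`);
  **Remark 1** / **Corollary 3.1** (the results of Krasnoselskij 1955 (`λ = 1/2`, `T` compact) and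
  Schaefer 1957 (`0 < λ < 1`) as special cases: compact, in particular finite-dimensional, settings)
  (bib: Berinde2007).

Everything is proved; there are no named facts and no `sorry`.

## What is formalised

`E` is a real inner product space (no completeness is needed for the algebra); `T : E → E` is
nonexpansive in the form `∀ x y, ‖T x − T y‖ ≤ ‖x − y‖`; `t : ℝ` is the relaxation parameter `λ`.

* `averagedMap T t = (1 − t) I + t T` and `kmIter T t x₀ n = (averagedMap T t)^[n] x₀` ((1), (2));
  `averagedMap_eq_self_iff` (same fixed points for `t ≠ 0`, Remark 1 of §4.3),
  `norm_averagedMap_sub_averagedMap_le` (`U_λ` is nonexpansive for `0 ≤ t ≤ 1`).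
* The inner-product identity `norm_sq_convex_combination`
  (`‖(1 − t)a + t b‖² = (1 − t)‖a‖² + t‖b‖² − t(1 − t)‖a − b‖²`) and the key inequality of the
  proof of Thm 3.2, `norm_averagedMap_sub_sq_le`
  (`‖U_λ x − p‖² + t(1 − t)‖x − T x‖² ≤ ‖x − p‖²` for a fixed point `p`, `0 ≤ t ≤ 1`).
* Along the iteration: Fejér monotonicity `norm_kmIter_succ_sub_le`, `antitone_norm_kmIter_sub`,
  `norm_kmIter_sub_le` (`‖x_n − p‖ ≤ ‖x₀ − p‖`); the telescoped bound
  `sum_norm_kmIter_sub_sq_le` (`Σ_{n<N} t(1 − t)‖x_n − T x_n‖² ≤ ‖x₀ − p‖²`); for `0 < t < 1`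
  summability `summable_norm_kmIter_sub_sq` and **asymptotic regularity**
  `tendsto_norm_kmIter_sub_apply` (`‖x_n − T x_n‖ → 0`) and `tendsto_kmIter_succ_sub`
  (`x_{n+1} − x_n → 0`, Remark 2 (3)).
* The concluding step of Thm 3.2: `tendsto_kmIter_of_subseq_tendsto` — if some subsequence
  `x_{φ k} → q` then `T q = q` and `x_n → q`; and the finite-dimensional (proper-space) theorem
  `exists_tendsto_kmIter` — if `T` is nonexpansive on a proper real inner product space and has a
  fixed point, then for `0 < t < 1` and every `x₀` the Krasnoselskij iteration converges to a fixed
  point of `T` (Thm 3.2 with demicompactness supplied by Bolzano–Weierstrass; Remark 1 / Cor 3.1).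

Deviations: [Ber07] states Thm 3.2 for a self-map of a bounded closed convex `C ⊆ H` and gets a
fixed point from Browder–Göhde–Kirk (his Thm 3.1); here `T` is defined on all of `E`, the existence of
a fixed point is a hypothesis, and boundedness of the orbit comes from Fejér monotonicity. Weak
convergence in infinite dimension (his Thms 3.3–3.4, Opial) is not formalised. This is the convergence
skeleton of the operator-splitting conic solvers (ADMM / Douglas–Rachford iterations are averaged maps),
whose fixed-point sets are described elsewhere in this topic; floating-point iterations are not modelled.
-/

open Filter Topology
open scoped RealInnerProductSpace

namespace Literature.Analysis.Convex.KrasnoselskijIteration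

variable {E : Type*} [NormedAddCommGroup E] [InnerProductSpace ℝ E]

/-! ## The averaged map and the iteration -/

/-- The **averaged map** `U_λ = (1 − λ) I + λ T` of `T` with parameter `t = λ`
((2) in the proof of Thm 3.2). [cite: Berinde2007, Ch. 3, Thm 3.2] -/
def averagedMap (T : E → E) (t : ℝ) (x : E) : E := (1 - t) • x + t • T x

/-- The **Krasnoselskij iteration** `x_{n+1} = (1 − λ) x_n + λ T x_n` started at `x₀`, i.e. the
Picard iteration of the averaged map (his (1) and Remark 3). [cite: Berinde2007, Ch. 3, Thm 3.2] -/
def kmIter (T : E → E) (t : ℝ) (x₀ : E) (n : ℕ) : E := (averagedMap T t)^[n] x₀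

variable {T : E → E} {t : ℝ} {x₀ p q x y : E}

/-- `x_0 = x₀`. [cite: Berinde2007, Ch. 3, Thm 3.2] -/
@[simp] theorem kmIter_zero : kmIter T t x₀ 0 = x₀ := rfl

/-- `x_{n+1} = U_λ x_n`. [cite: Berinde2007, Ch. 3, Thm 3.2] -/
theorem kmIter_succ (n : ℕ) : kmIter T t x₀ (n + 1) = averagedMap T t (kmIter T t x₀ n) :=
  Function.iterate_succ_apply' _ _ _

/-- `U_λ x − x = λ (T x − x)`: the step of the iteration is `λ` times the residual.
[cite: Berinde2007, Ch. 3, Thm 3.2] -/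
theorem averagedMap_sub_self (T : E → E) (t : ℝ) (x : E) :
    averagedMap T t x - x = t • (T x - x) := by
  simp only [averagedMap, smul_sub, sub_smul, one_smul]
  abel

/-- For `λ ≠ 0` the averaged map has the same fixed points as `T` (Remark 1 in §4.3: "`T_λ` … has the
same fixed points set as `T`"). [cite: Berinde2007, Ch. 3, Thm 3.2] -/
theorem averagedMap_eq_self_iff (ht : t ≠ 0) : averagedMap T t x = x ↔ T x = x := by
  rw [← sub_eq_zero, averagedMap_sub_self, smul_eq_zero, sub_eq_zero]
  exact ⟨fun h => h.resolve_left ht, fun h => Or.inr h⟩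

/-- A fixed point of `T` is a fixed point of every `U_λ`. [cite: Berinde2007, Ch. 3, Thm 3.2] -/
theorem averagedMap_eq_self_of_eq (hp : T p = p) : averagedMap T t p = p := by
  rw [← sub_eq_zero, averagedMap_sub_self, hp, sub_self, smul_zero]

/-- A fixed point of `T` is fixed by the whole iteration: `x_n = p` if `x₀ = p`.
[cite: Berinde2007, Ch. 3, Thm 3.2] -/
theorem kmIter_eq_self_of_eq (hp : T p = p) (n : ℕ) : kmIter T t p n = p := by
  induction n with
  | zero => rfl
  | succ n ih => rw [kmIter_succ, ih, averagedMap_eq_self_of_eq hp]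

/-! ## The Hilbert-space inequality behind Theorem 3.2 -/

/-- The identity for a convex combination in a real inner product space behind the proof of
Thm 3.2: `‖(1 − t) a + t b‖² = (1 − t)‖a‖² + t‖b‖² − t(1 − t)‖a − b‖²` (Berinde expands
`‖x_{n+1} − p‖² = (1 − λ)²‖x_n − p‖² + λ²‖T x_n − p‖² + 2λ(1 − λ)⟨T x_n − p, x_n − p⟩` and
`a²‖x_n − T x_n‖²`; this is the same computation organised as one identity, with `a = x_n − p`,
`b = T x_n − p`). [cite: Berinde2007, Ch. 3, Thm 3.2] -/
theorem norm_sq_convex_combination (a b : E) (t : ℝ) :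
    ‖(1 - t) • a + t • b‖ ^ 2 =
      (1 - t) * ‖a‖ ^ 2 + t * ‖b‖ ^ 2 - t * (1 - t) * ‖a - b‖ ^ 2 := by
  rw [norm_add_sq_real, norm_sub_sq_real, norm_smul, norm_smul, real_inner_smul_left,
    real_inner_smul_right, Real.norm_eq_abs, Real.norm_eq_abs, mul_pow, mul_pow, sq_abs, sq_abs]
  ring

omit [InnerProductSpace ℝ E] in
/-- `T` nonexpansive and `T p = p` give `‖T x − p‖ ≤ ‖x − p‖`. [cite: Berinde2007, Ch. 3, Thm 3.2] -/
theorem norm_apply_sub_le (hT : ∀ x y, ‖T x - T y‖ ≤ ‖x - y‖) (hp : T p = p) (x : E) :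
    ‖T x - p‖ ≤ ‖x - p‖ := by
  have h := hT x p
  rwa [hp] at h

/-- **The key inequality of the proof of Theorem 3.2** (with the optimal `a² = λ(1 − λ)`):
for `T` nonexpansive with fixed point `p` and `0 ≤ t ≤ 1`,
`‖U_λ x − p‖² + t(1 − t)‖x − T x‖² ≤ ‖x − p‖²`. [cite: Berinde2007, Ch. 3, Thm 3.2] -/
theorem norm_averagedMap_sub_sq_le (hT : ∀ x y, ‖T x - T y‖ ≤ ‖x - y‖) (hp : T p = p)
    (ht0 : 0 ≤ t) (x : E) :
    ‖averagedMap T t x - p‖ ^ 2 + t * (1 - t) * ‖x - T x‖ ^ 2 ≤ ‖x - p‖ ^ 2 := by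
  have e : averagedMap T t x - p = (1 - t) • (x - p) + t • (T x - p) := by
    simp only [averagedMap, smul_sub, sub_smul, one_smul]
    abel
  have e2 : (x - p) - (T x - p) = x - T x := by abel
  rw [e, norm_sq_convex_combination, e2]
  have hb : ‖T x - p‖ ≤ ‖x - p‖ := norm_apply_sub_le hT hp x
  have hb2 : ‖T x - p‖ ^ 2 ≤ ‖x - p‖ ^ 2 := pow_le_pow_left₀ (norm_nonneg _) hb 2
  have key : t * ‖T x - p‖ ^ 2 ≤ t * ‖x - p‖ ^ 2 := mul_le_mul_of_nonneg_left hb2 ht0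
  linarith

/-- **Fejér monotonicity of one step**: `‖U_λ x − p‖ ≤ ‖x − p‖` for `0 ≤ t ≤ 1`
("`‖x_{n+1} − p‖ ≤ ‖x_n − p‖`, which can be deduced from the nonexpansiveness of `T`").
[cite: Berinde2007, Ch. 3, Thm 3.2] -/
theorem norm_averagedMap_sub_le (hT : ∀ x y, ‖T x - T y‖ ≤ ‖x - y‖) (hp : T p = p)
    (ht0 : 0 ≤ t) (ht1 : t ≤ 1) (x : E) : ‖averagedMap T t x - p‖ ≤ ‖x - p‖ := by
  have h := norm_averagedMap_sub_sq_le hT hp ht0 x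
  have h2 : 0 ≤ t * (1 - t) * ‖x - T x‖ ^ 2 :=
    mul_nonneg (mul_nonneg ht0 (sub_nonneg.2 ht1)) (sq_nonneg _)
  exact (sq_le_sq₀ (norm_nonneg _) (norm_nonneg _)).1 (by linarith)

/-- The averaged map of a nonexpansive map is nonexpansive (`0 ≤ t ≤ 1`).
[cite: Berinde2007, Ch. 3, Thm 3.2] -/
theorem norm_averagedMap_sub_averagedMap_le (hT : ∀ x y, ‖T x - T y‖ ≤ ‖x - y‖)
    (ht0 : 0 ≤ t) (ht1 : t ≤ 1) (x y : E) :
    ‖averagedMap T t x - averagedMap T t y‖ ≤ ‖x - y‖ := by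
  have e : averagedMap T t x - averagedMap T t y = (1 - t) • (x - y) + t • (T x - T y) := by
    simp only [averagedMap, smul_sub]
    abel
  rw [e]
  calc ‖(1 - t) • (x - y) + t • (T x - T y)‖
      ≤ ‖(1 - t) • (x - y)‖ + ‖t • (T x - T y)‖ := norm_add_le _ _
    _ = (1 - t) * ‖x - y‖ + t * ‖T x - T y‖ := by
        rw [norm_smul, norm_smul, Real.norm_eq_abs, Real.norm_eq_abs, abs_of_nonneg ht0,
          abs_of_nonneg (sub_nonneg.2 ht1)]
    _ ≤ (1 - t) * ‖x - y‖ + t * ‖x - y‖ := by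
        gcongr
        exact hT x y
    _ = ‖x - y‖ := by ring

/-! ## Along the iteration: Fejér monotonicity and asymptotic regularity -/

/-- `‖x_{n+1} − p‖ ≤ ‖x_n − p‖`. [cite: Berinde2007, Ch. 3, Thm 3.2] -/
theorem norm_kmIter_succ_sub_le (hT : ∀ x y, ‖T x - T y‖ ≤ ‖x - y‖) (hp : T p = p)
    (ht0 : 0 ≤ t) (ht1 : t ≤ 1) (n : ℕ) :
    ‖kmIter T t x₀ (n + 1) - p‖ ≤ ‖kmIter T t x₀ n - p‖ := by
  rw [kmIter_succ]
  exact norm_averagedMap_sub_le hT hp ht0 ht1 _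

/-- The distances `‖x_n − p‖` to a fixed point are non-increasing (Fejér monotone sequence).
[cite: Berinde2007, Ch. 3, Thm 3.2] -/
theorem antitone_norm_kmIter_sub (hT : ∀ x y, ‖T x - T y‖ ≤ ‖x - y‖) (hp : T p = p)
    (ht0 : 0 ≤ t) (ht1 : t ≤ 1) : Antitone fun n => ‖kmIter T t x₀ n - p‖ :=
  antitone_nat_of_succ_le fun n => norm_kmIter_succ_sub_le hT hp ht0 ht1 n

/-- `‖x_n − p‖ ≤ ‖x₀ − p‖`: the orbit stays in the ball around any fixed point through `x₀`
(boundedness of the iteration). [cite: Berinde2007, Ch. 3, Thm 3.2] -/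
theorem norm_kmIter_sub_le (hT : ∀ x y, ‖T x - T y‖ ≤ ‖x - y‖) (hp : T p = p)
    (ht0 : 0 ≤ t) (ht1 : t ≤ 1) (n : ℕ) : ‖kmIter T t x₀ n - p‖ ≤ ‖x₀ - p‖ := by
  simpa using antitone_norm_kmIter_sub (x₀ := x₀) hT hp ht0 ht1 (Nat.zero_le n)

/-- **Telescoped key inequality**: `Σ_{n<N} t(1 − t)‖x_n − T x_n‖² ≤ ‖x₀ − p‖² − ‖x_N − p‖²`.
[cite: Berinde2007, Ch. 3, Thm 3.2] -/
theorem sum_norm_kmIter_sub_sq_le' (hT : ∀ x y, ‖T x - T y‖ ≤ ‖x - y‖) (hp : T p = p)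
    (ht0 : 0 ≤ t) (N : ℕ) :
    ∑ n ∈ Finset.range N, t * (1 - t) * ‖kmIter T t x₀ n - T (kmIter T t x₀ n)‖ ^ 2 ≤
      ‖x₀ - p‖ ^ 2 - ‖kmIter T t x₀ N - p‖ ^ 2 := by
  induction N with
  | zero => simp
  | succ N ih =>
    rw [Finset.sum_range_succ, kmIter_succ]
    have h := norm_averagedMap_sub_sq_le hT hp ht0 (kmIter T t x₀ N)
    linarith

/-- `Σ_{n<N} t(1 − t)‖x_n − T x_n‖² ≤ ‖x₀ − p‖²`, uniformly in `N`
("which shows that `Σ ‖x_n − T x_n‖² < ∞`"). [cite: Berinde2007, Ch. 3, Thm 3.2] -/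
theorem sum_norm_kmIter_sub_sq_le (hT : ∀ x y, ‖T x - T y‖ ≤ ‖x - y‖) (hp : T p = p)
    (ht0 : 0 ≤ t) (N : ℕ) :
    ∑ n ∈ Finset.range N, t * (1 - t) * ‖kmIter T t x₀ n - T (kmIter T t x₀ n)‖ ^ 2 ≤
      ‖x₀ - p‖ ^ 2 := by
  have h := sum_norm_kmIter_sub_sq_le' (x₀ := x₀) hT hp ht0 N
  have h2 : 0 ≤ ‖kmIter T t x₀ N - p‖ ^ 2 := sq_nonneg _
  linarith

/-- For `0 < t < 1` the squared residuals are summable: `Σ ‖x_n − T x_n‖² < ∞`.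
[cite: Berinde2007, Ch. 3, Thm 3.2] -/
theorem summable_norm_kmIter_sub_sq (hT : ∀ x y, ‖T x - T y‖ ≤ ‖x - y‖) (hp : T p = p)
    (ht0 : 0 < t) (ht1 : t < 1) :
    Summable fun n => ‖kmIter T t x₀ n - T (kmIter T t x₀ n)‖ ^ 2 := by
  have hc : 0 < t * (1 - t) := mul_pos ht0 (sub_pos.2 ht1)
  refine summable_of_sum_range_le (c := ‖x₀ - p‖ ^ 2 / (t * (1 - t))) (fun n => sq_nonneg _)
    fun N => ?_
  rw [le_div_iff₀ hc]
  have h := sum_norm_kmIter_sub_sq_le (x₀ := x₀) hT hp ht0.le N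
  calc (∑ n ∈ Finset.range N, ‖kmIter T t x₀ n - T (kmIter T t x₀ n)‖ ^ 2) * (t * (1 - t))
      = ∑ n ∈ Finset.range N, t * (1 - t) * ‖kmIter T t x₀ n - T (kmIter T t x₀ n)‖ ^ 2 := by
        rw [Finset.sum_mul]
        exact Finset.sum_congr rfl fun n _ => by ring
    _ ≤ ‖x₀ - p‖ ^ 2 := h

/-- **Asymptotic regularity**: for `0 < t < 1`, `‖x_n − T x_n‖ → 0`.
[cite: Berinde2007, Ch. 3, Thm 3.2] -/
theorem tendsto_norm_kmIter_sub_apply (hT : ∀ x y, ‖T x - T y‖ ≤ ‖x - y‖) (hp : T p = p)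
    (ht0 : 0 < t) (ht1 : t < 1) :
    Tendsto (fun n => ‖kmIter T t x₀ n - T (kmIter T t x₀ n)‖) atTop (𝓝 0) := by
  have hsq := (summable_norm_kmIter_sub_sq (x₀ := x₀) hT hp ht0 ht1).tendsto_atTop_zero
  have hsqrt := (Real.continuous_sqrt.tendsto 0).comp hsq
  rw [Real.sqrt_zero] at hsqrt
  refine hsqrt.congr fun n => ?_
  simp only [Function.comp_apply]
  exact Real.sqrt_sq (norm_nonneg _)

/-- The residual vectors themselves tend to zero: `x_n − T x_n → 0`.
[cite: Berinde2007, Ch. 3, Thm 3.2] -/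
theorem tendsto_kmIter_sub_apply (hT : ∀ x y, ‖T x - T y‖ ≤ ‖x - y‖) (hp : T p = p)
    (ht0 : 0 < t) (ht1 : t < 1) :
    Tendsto (fun n => kmIter T t x₀ n - T (kmIter T t x₀ n)) atTop (𝓝 0) :=
  tendsto_zero_iff_norm_tendsto_zero.2 (tendsto_norm_kmIter_sub_apply hT hp ht0 ht1)

/-- **Remark 2, (3)**: `x_{n+1} − x_n → 0` (the averaged map is asymptotically regular).
[cite: Berinde2007, Ch. 3, Remark 2 after Thm 3.2] -/
theorem tendsto_kmIter_succ_sub (hT : ∀ x y, ‖T x - T y‖ ≤ ‖x - y‖) (hp : T p = p)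
    (ht0 : 0 < t) (ht1 : t < 1) :
    Tendsto (fun n => kmIter T t x₀ (n + 1) - kmIter T t x₀ n) atTop (𝓝 0) := by
  have h := (tendsto_kmIter_sub_apply (x₀ := x₀) hT hp ht0 ht1).const_smul (-t)
  rw [smul_zero] at h
  refine h.congr fun n => ?_
  rw [kmIter_succ, averagedMap_sub_self, neg_smul, ← smul_neg, neg_sub]

/-! ## Convergence -/

/-- **The concluding step of Theorem 3.2** (where [Ber07] uses demicompactness): if some
subsequence of the Krasnoselskij iteration converges (strongly) to `q`, then `T q = q` and the whole
sequence converges to `q`. [cite: Berinde2007, Ch. 3, Thm 3.2] -/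
theorem tendsto_kmIter_of_subseq_tendsto (hT : ∀ x y, ‖T x - T y‖ ≤ ‖x - y‖) (hp : T p = p)
    (ht0 : 0 < t) (ht1 : t < 1) {φ : ℕ → ℕ} (hφ : StrictMono φ)
    (hlim : Tendsto (fun k => kmIter T t x₀ (φ k)) atTop (𝓝 q)) :
    T q = q ∧ Tendsto (kmIter T t x₀) atTop (𝓝 q) := by
  have hcont : Continuous T :=
    (LipschitzWith.of_dist_le_mul (K := 1) fun a b => by
      simpa only [NNReal.coe_one, one_mul, dist_eq_norm] using hT a b).continuous
  -- the residual is continuous and tends to zero along the subsequence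
  have hresφ : Tendsto (fun k => kmIter T t x₀ (φ k) - T (kmIter T t x₀ (φ k))) atTop (𝓝 0) :=
    (tendsto_kmIter_sub_apply (x₀ := x₀) hT hp ht0 ht1).comp hφ.tendsto_atTop
  have hres' : Tendsto (fun k => kmIter T t x₀ (φ k) - T (kmIter T t x₀ (φ k))) atTop
      (𝓝 (q - T q)) :=
    hlim.sub ((hcont.tendsto q).comp hlim)
  have hq : q - T q = 0 := tendsto_nhds_unique hres' hresφ
  have hTq : T q = q := (sub_eq_zero.1 hq).symm
  refine ⟨hTq, ?_⟩
  -- Fejér monotonicity with respect to the fixed point `q`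
  have hanti : Antitone fun n => ‖kmIter T t x₀ n - q‖ :=
    antitone_norm_kmIter_sub hT hTq ht0.le ht1.le
  have hdφ : Tendsto (fun k => ‖kmIter T t x₀ (φ k) - q‖) atTop (𝓝 0) := by
    have h := tendsto_iff_norm_sub_tendsto_zero.1 hlim
    exact h
  rw [tendsto_iff_norm_sub_tendsto_zero, Metric.tendsto_atTop]
  intro ε hε
  obtain ⟨K, hK⟩ := (Metric.tendsto_atTop.1 hdφ) ε hε
  refine ⟨φ K, fun n hn => ?_⟩
  have h1 : ‖kmIter T t x₀ n - q‖ ≤ ‖kmIter T t x₀ (φ K) - q‖ := hanti hn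
  have h2 := hK K le_rfl
  rw [Real.dist_eq, sub_zero, abs_of_nonneg (norm_nonneg _)] at h2 ⊢
  exact lt_of_le_of_lt h1 h2

/-- **Theorem 3.2 in finite dimension (Krasnoselskij 1955 / Schaefer 1957, Remark 1 and
Corollary 3.1)**: on a proper (e.g. finite-dimensional) real inner product space, if `T` is
nonexpansive and has a fixed point, then for every `0 < t < 1` and every starting point the
Krasnoselskij iteration `x_{n+1} = (1 − t) x_n + t T x_n` converges to a fixed point of `T`.
[cite: Berinde2007, Ch. 3, Thm 3.2 and Cor 3.1] -/
theorem exists_tendsto_kmIter [ProperSpace E] (hT : ∀ x y, ‖T x - T y‖ ≤ ‖x - y‖)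
    (hfix : ∃ p, T p = p) (ht0 : 0 < t) (ht1 : t < 1) (x₀ : E) :
    ∃ q, T q = q ∧ Tendsto (kmIter T t x₀) atTop (𝓝 q) := by
  obtain ⟨p, hp⟩ := hfix
  have hbd : ∀ n, kmIter T t x₀ n ∈ Metric.closedBall p ‖x₀ - p‖ := fun n => by
    rw [Metric.mem_closedBall, dist_eq_norm]
    exact norm_kmIter_sub_le hT hp ht0.le ht1.le n
  obtain ⟨q, -, φ, hφ, hlim⟩ := tendsto_subseq_of_bounded Metric.isBounded_closedBall hbd
  exact ⟨q, tendsto_kmIter_of_subseq_tendsto hT hp ht0 ht1 hφ hlim⟩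

/-- The limit is also the limit of `T x_n` (since `x_n − T x_n → 0`).
[cite: Berinde2007, Ch. 3, Thm 3.2] -/
theorem tendsto_apply_kmIter (hT : ∀ x y, ‖T x - T y‖ ≤ ‖x - y‖) (hp : T p = p)
    (ht0 : 0 < t) (ht1 : t < 1) (hlim : Tendsto (kmIter T t x₀) atTop (𝓝 q)) :
    Tendsto (fun n => T (kmIter T t x₀ n)) atTop (𝓝 q) := by
  have h := hlim.sub (tendsto_kmIter_sub_apply (x₀ := x₀) hT hp ht0 ht1)
  rw [sub_zero] at h
  exact h.congr fun n => sub_sub_cancel _ _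

end Literature.Analysis.Convex.KrasnoselskijIteration
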